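import Summits.AnomalousDissipation.AnomalousDissipation.Theses.TwoAndHalfD
import Literature.Analysis.FluidPDE.TwoHalfNavierStokes
import Literature.Analysis.FluidPDE.LongTimeAverageNonneg
import Summits.AnomalousDissipation.AnomalousDissipation.Theorems.TwohalfdNeg.Negative.LoadBearing
import Summits.AnomalousDissipation.AnomalousDissipation.Theorems.TwohalfdNeg.Negative.ZeroMeanAndKillShape

/-!
# Line `log-kantorovich-enstrophy-transfer` for crux `TwoAndHalfD.TwohalfdNeg`
# (stmt-AnomalousDissipation-0211) — checked skeleton (crux-plan, round 1, 2026-08-16)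

Idea card: `Cruxes/TwohalfdNeg/Ideas/log-kantorovich-enstrophy-transfer.md` (triage r1-1/2/3: pass,
merge with `replica-log-cost-enstrophy-threshold` ≈ `lusin-lipschitz-log-count`, adapter
`age-decoupling-finite-window`). Line card: `Lines/log-kantorovich-enstrophy-transfer.md`.

THE LINE. A scalar with bounded inventory (variance) can only be burnt as fast as the planar flow can
pay the LOGARITHMIC transport bill: the dissipation of a RELEASE of the fixed smooth profile `h` inside
a window of length `T` is `≤ C(h,T₀)·(∫_window ‖∇v‖_{L²} + 1)/log(1/ν)` (S4, the log-Kantorovich /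
Crippa–De Lellis engine, two-point form); the steadily SOURCED scalar with bounded variance dissipates
at most `R/(2S) + √(2R·D̄(S))`, `D̄(S)` = mean window-`S` loss of releases of `h` (S3, age decoupling);
hence the scalar half of the crux holds for every planar family whose mean strain is `o(log 1/ν)`
(S5), and the crux is TRANSFERRED to the purely two-dimensional growth law `SubLogStrain` (S6, C⁺,
the open residual). The planar half is Alexakis–Doering (S2) and the `x₃`-invariant bookkeeping is S1.

STUBS (all stated over tree vocabulary only — no local `def`, no notation — so that each can be
landed verbatim as `Theorems/TwohalfdNeg/<Stub>.lean --supports stmt-AnomalousDissipation-0211`;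
helper files copy the `open` lines below and the statement byte-for-byte):
* S1 `stub_reduction`      — x₃-invariant Leray–Hopf family = `twoHalf` (planar LH family, sourced
                              weak scalar family); energies split; dissipation sub-splits.   [M]
* S2 `stub_planarNoAnomaly` — Alexakis–Doering for ALL `L²` data, any smooth steady `g`, `U ≥ 0`. [M−]
* S3 `stub_ageDecoupling`   — sourced→release adapter `(★★) χ ≤ R/(2S) + √(2R·D̄(S))`: the scalar
                              half holds for a family whose releases of `h` are FINITE-WINDOW QUIET. [M–L]
* S4 `stub_releaseLogBound` — THE ENGINE (K1): window dissipation of a release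
                              `≤ C(H,L,T₀)(S+1)/log(1/κ)`, `S = ∫‖∇u‖_{L²}`, every weak solution. [L]
* S5 `stub_quietOfSubLog`   — S4 + sub-log mean strain ⇒ finite-window quiet (sliding windows,
                              limsup bookkeeping).                                            [M]
* S6 `stub_subLogStrain`    — TRANSFER TARGET C⁺: bounded-energy steadily forced planar LH families
                              have `⟨‖∇v_j‖_{L²}⟩ = o(log(1/ν_j))`. OPEN (the residual crux).  [XL]
Composition `TwohalfdNeg_of` (kernel-checked, no sorry of its own): S1 splits; S2 kills the planar
part; S6 → S5(S4) → S3 kills the scalar part; squeeze with `meanDissipation_nonneg`.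

DISPROOF USED (`Cruxes/TwohalfdNeg/Disproof.lean` @ 2026-08-16T01:37Z; certified copies under
`Theorems/TwohalfdNeg/Negative/` — `LoadBearing` (+ `LaminarShear`) imported above, `ZeroMeanAndKillShape`
(§5–§6, p74035) not yet built on the farm snapshot at check time, cited by name):
`twohalfdNeg_false_without_energyBound` — the energy
ceiling is consumed in S1 (it is what bounds `⟨‖v_j‖²⟩` AND the scalar variance `R`) and then by S2
(`U` bounded), S3 (`R`), S6; `twohalfdNeg_false_without_vanishingViscosity` — `ν_j → 0` is used in S2
(rate `ν^{1/2}`), S5 (`1/log(1/ν_j) → 0`), S6; `twohalfdNeg_false_without_fixedForce` — the ONE fixed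
`h` enters S3/S5 (finite-window quiet for that `h`) and S4's constant `C(H, L, T₀)` carries
`H = sup|h|`, `L = sup‖∇h‖` (for the refuting family `f_j = 4π²cos(2π(j+1)x₀)e₃`, `L_j → ∞`: consistent),
the fixed `g` enters S2 through `‖Δg‖` and S6; `twohalfdNeg_false_without_zeroMeanForce` — `∫h = 0`
is used in S3 (the scalar mean is conserved, so bounded variance is honest) and `∫g = 0` in S1/S2
(momentum bookkeeping); kill shape `twohalfdNeg_iff_not_twohalfdThesis` — n/a (this is the proof
side). No stub is an instance of a landed Negative lemma (each keeps the energy ceiling, `ν_j → 0`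
where needed, and ONE fixed smooth force/source). `ledger negatives` (4 entries): none related.
-/

namespace Summit.AnomalousDissipation.AnomalousDissipation.Cruxes.TwohalfdNeg.LogKantorovichEnstrophyTransfer

open MeasureTheory Filter Topology
open scoped ENNReal NNReal
open Literature.Analysis.FunctionSpaces Literature.Analysis.FluidPDE

set_option linter.dupNamespace false

/-! ## §0 Sanity: the landed Negative lemmas are in scope (lead, 2026-08-16) -/

/-- Kill shape (landed, `Negative/ZeroMeanAndKillShape.lean`, p74035): the crux is exactly `¬ X`. -/
example : Summit.AnomalousDissipation.AnomalousDissipation.Theses.TwoAndHalfD.TwohalfdNeg ↔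
    ¬ Summit.AnomalousDissipation.AnomalousDissipation.Theses.TwoAndHalfD.TwohalfdThesis :=
  Summit.AnomalousDissipation.AnomalousDissipation.Theorems.TwohalfdNeg.Negative.twohalfdNeg_iff_not_twohalfdThesis

/-- The fixed force is load-bearing (landed, `Negative/LoadBearing.lean`, p73808): S3/S5 carry the ONE `h`,
S4's constant is `C(H, L, T₀)`, S2/S6 carry the ONE `g`. -/
example : ¬ Summit.AnomalousDissipation.AnomalousDissipation.Theorems.TwohalfdNeg.Negative.TwohalfdNegWithoutFixedForce :=
  Summit.AnomalousDissipation.AnomalousDissipation.Theorems.TwohalfdNeg.Negative.twohalfdNeg_false_without_fixedForce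

/-! ## S1 — the `x₃`-invariant reduction (K3 of the card) -/

/-- **S1 `stub_reduction` — an `x₃`-invariant Leray–Hopf family under an `x₃`-invariant steady force
IS a `2½`-dimensional pair, with split budgets.** For `f` smooth, solenoidal, mean zero and invariant
under `x ↦ x + s e₃`, and `x₃`-invariant global Leray–Hopf solutions `u_j` of NS_{ν_j} forced by `f`
with `ν`-uniformly bounded limsup-mean energy: `f = twoHalf g h` and `u_j(t) = twoHalf (v_j t) (θ_j t)`
where `g` (smooth, divergence free, mean zero) and `h` (smooth, mean zero) are the planar sections,
`v_j` is a global Leray–Hopf solution of the TWO-dimensional system forced by `g` (weak formulation: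
test the 3-D one against lifted planar solenoidal fields; energy inequality: 2-D weak solutions in
`L^∞L² ∩ L²H¹` are unique and satisfy the energy EQUALITY — `lions_prodi_uniqueness_torus2_holds`),
`θ_j` is a global weak solution of the SOURCED advection–diffusion equation
`∂ₜθ + v_j·∇θ = ν_jΔθ + h` (test against `(0,0,ψ∘π)`) from `L²` data, the planar mean energy and the
scalar mean variance are bounded by the 3-D mean energy (`∫_{T³}‖u‖² = ∫_{T²}‖v‖² + ∫_{T²}θ²`,
`Torus.integral_norm_sq_twoHalf`; monotonicity of limsup means), and the mean dissipation
SUB-splits: `⟨ν‖∇u_j‖²⟩ ≤ ⟨ν‖∇v_j‖²⟩ + ⟨ν‖∇θ_j‖²⟩` (spectral identity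
`eGradNormSq (twoHalf v θ) = eGradNormSq v + eScalarGradNormSq θ` slice-wise — Fourier coefficients
of a planar lift live on `k₃ = 0`, `Torus.toReal_eGradNormSq_twoHalf` for smooth slices — and
subadditivity of `limsup` Cesàro means). Tree: `Torus.eq_twoHalf_of_forall_add_single`
(`Fin.last 2 = 2`), `TorusAxisAverage(Calculus)`, `TwoHalfWeakEuler` (the same bookkeeping for weak
Euler), `measurePreserving_planarShear`. Datum: `u₀_j` is only a.e. invariant (strong initial trace),
so `v₀_j, θ₀_j` are the sections of its invariant representative. Uses `HasZeroMean f` (honest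
means: momentum bookkeeping) and the energy ceiling — cf. `Negative.twohalfdNeg_false_without_energyBound`,
`Negative.twohalfdNeg_false_without_zeroMeanForce`. Size M. -/
theorem stub_reduction :
    ∀ f : UnitAddTorus (Fin 3) → EuclideanSpace ℝ (Fin 3),
      (∀ (s : UnitAddCircle) (x : UnitAddTorus (Fin 3)), f (x + Pi.single (2 : Fin 3) s) = f x) →
      Torus.IsSmooth f → Torus.IsDivFree f → Torus.HasZeroMean f →
      ∀ (ν : ℕ → ℝ) (u₀ : ℕ → UnitAddTorus (Fin 3) → EuclideanSpace ℝ (Fin 3))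
        (u : ℕ → ℝ → UnitAddTorus (Fin 3) → EuclideanSpace ℝ (Fin 3)),
        (∀ j, 0 < ν j) →
        (∀ j, Torus.IsGlobalLerayHopf (ν j) (fun _ => f) (u₀ j) (u j)) →
        (∀ j (t : ℝ) (s : UnitAddCircle) (x : UnitAddTorus (Fin 3)),
          u j t (x + Pi.single (2 : Fin 3) s) = u j t x) →
        (∃ E : ℝ, ∀ j, meanEnergy (u j) ≤ E) →
        ∃ (g : UnitAddTorus (Fin 2) → EuclideanSpace ℝ (Fin 2)) (h : UnitAddTorus (Fin 2) → ℝ)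
          (v₀ : ℕ → UnitAddTorus (Fin 2) → EuclideanSpace ℝ (Fin 2))
          (v : ℕ → ℝ → UnitAddTorus (Fin 2) → EuclideanSpace ℝ (Fin 2))
          (θ₀ : ℕ → UnitAddTorus (Fin 2) → ℝ) (θ : ℕ → ℝ → UnitAddTorus (Fin 2) → ℝ),
          Torus.IsSmooth g ∧ Torus.IsDivFree g ∧ Torus.HasZeroMean g ∧
          Torus.IsSmooth h ∧ Torus.HasZeroMean h ∧
          f = Torus.twoHalf g h ∧ (∀ j (t : ℝ), u j t = Torus.twoHalf (v j t) (θ j t)) ∧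
          (∀ j, Torus.IsGlobalLerayHopf (ν j) (fun _ => g) (v₀ j) (v j)) ∧
          (∀ j, MemLp (θ₀ j) 2 volume) ∧
          (∀ j, Torus.IsWeakScalarTransportForced (ν j) (v j) (fun _ => h) (θ₀ j) (θ j)) ∧
          (∃ E : ℝ, ∀ j, meanEnergy (v j) ≤ E) ∧
          (∃ E : ℝ, ∀ j, longTimeAvgSup (fun t => Torus.scalarL2Sq (θ j t)) ≤ E) ∧
          (∀ j, meanDissipation (ν j) (u j) ≤
            meanDissipation (ν j) (v j) +
              longTimeAvgSup (fun t => ν j * (Torus.eScalarGradNormSq (θ j t)).toReal)) := by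
  sorry

/-! ## S2 — the planar half: Alexakis–Doering for all data -/

/-- **S2 `stub_planarNoAnomaly` — no energy-dissipation anomaly for bounded-energy steadily forced
2-D Leray–Hopf families, ALL `L²` data.** For every smooth divergence-free mean-zero steady `g` on
`T²` (including `g = 0`), `ν_j → 0` and global Leray–Hopf `v_j` with `sup_j ⟨‖v_j‖²⟩ < ∞`:
`⟨ν_j‖∇v_j‖²⟩ → 0`. Why true: `ε² ≤ ν U² χ` and `χ ≤ ‖Δg‖₂ U` (Alexakis–Doering 2006 §2; tree:
`meanDissipation_sq_le_of_enstrophyBalance`, `meanEnstrophyDissipation_le_of_enstrophyBalance`,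
`fmrt_enstrophy_balance_torus2_holds`, `Literature.Barriers.AnomalousDissipation.AlexakisDoering2006_energyDissipationBound_holds`)
give `ε_j ≤ (ν_j U³‖Δg‖)^{1/2} → 0`; the vendored forms want an `H¹`/smooth datum and `U > 0`:
restart at an a.e. time `s` with `v_j(s) ∈ H¹` (Leray–Hopf energy-inequality times; limsup means are
shift invariant) and treat `U_j = 0` by the Doering–Foias power budget `ε ≤ ‖g‖₂ U`
(`DoeringFoias2002_dissipation_le_power_holds`). Nonzero momentum is harmless (all estimates are blind
to constants; `∫g = 0` keeps the momentum constant). This is the catalogued barrier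
`AlexakisDoering2006_energyDissipationBound` USED, not evaded. Size M−. -/
theorem stub_planarNoAnomaly :
    ∀ g : UnitAddTorus (Fin 2) → EuclideanSpace ℝ (Fin 2),
      Torus.IsSmooth g → Torus.IsDivFree g → Torus.HasZeroMean g →
      ∀ (ν : ℕ → ℝ) (v₀ : ℕ → UnitAddTorus (Fin 2) → EuclideanSpace ℝ (Fin 2))
        (v : ℕ → ℝ → UnitAddTorus (Fin 2) → EuclideanSpace ℝ (Fin 2)),
        (∀ j, 0 < ν j) → Tendsto ν atTop (𝓝 0) →
        (∀ j, Torus.IsGlobalLerayHopf (ν j) (fun _ => g) (v₀ j) (v j)) →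
        (∃ E : ℝ, ∀ j, meanEnergy (v j) ≤ E) →
        Tendsto (fun j => meanDissipation (ν j) (v j)) atTop (𝓝 0) := by
  sorry

/-! ## S3 — the sourced → release adapter (age decoupling) -/

/-- **S3 `stub_ageDecoupling` — a steadily sourced scalar with bounded variance cannot dissipate
unless RELEASES of its own source profile dissipate inside finite windows.** Planar global
Leray–Hopf drifts `v_j` (force `g`, viscosity `ν_j > 0`), the FIXED smooth mean-zero source `h`,
global weak sourced scalars `θ_j` (Prandtl number one) from `L²` data with
`sup_j ⟨‖θ_j‖²⟩ ≤ R < ∞`. HYPOTHESIS (finite-window quiet, FOR THIS `h`): for every window `S > 0`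
and every family `ϑ j s` of weak RELEASES of `h` at times `s > 0` into `v_j`
(`∂_τϑ + v_j(s+τ)·∇ϑ = ν_jΔϑ`, `ϑ(0) = h`, weak on `[0, S+1)`), the long-time mean over release times
`s` of the age-`S` dissipation `ν_j∫₀^S‖∇ϑ‖²` tends to `0` as `j → ∞`. CONCLUSION: the mean scalar
dissipation `χ_j = ⟨ν_j‖∇θ_j‖²⟩ → 0`. Why true — the age-decoupling inequality (★★)
`χ ≤ R/(2S) + √(2R·D̄(S))` for every `S > 0` at each fixed `j` (card age-decoupling-finite-window,
verified line by line by all three triagers): `χ = ⟨(h,θ)⟩` (energy equality; `‖θ_j(t) - ∫θ₀‖` is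
bounded in `t` at fixed `ν_j > 0` because `∫h = 0` keeps the mean constant and Poincaré damps the
rest); Duhamel `θ(t) = Φ_{t-σ→t}θ(t-σ) + ∫_{t-σ}^t Φ_{r→t}h dr` with the release operator `Φ`;
for two releases `d/dτ(a,b) = -2ν(∇a,∇b)` (advection cancels, `div v = 0`), so
`(h, θ(t-σ)) ≤ (Φ_{t-σ→t}h, θ(t) - Y_σ(t)) + √(2 D_h(t-σ;S))‖θ(t-σ)‖`, `Y_σ = ∫₀^σ Φ_{t-σ'→t}h dσ'`;
integrate `σ ∈ [0,S]` and complete the square, `(Y_S,θ) - ½‖Y_S‖² ≤ ½‖θ‖²`; long-time limsup in `t`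
(shift costs `O(S²/T)`, Cauchy–Schwarz in time, subadditivity). Then the hypothesis (applied to the
energy releases, which the prover constructs) gives `D̄_j(S) → 0`, so `limsup_j χ_j ≤ R/(2S)` for
every `S`. Needs the linear well-posedness package for advection–diffusion over 2-D Leray–Hopf
drifts (`v ∈ L^∞L² ∩ L²H¹ ⊂ L⁴_{t,x}`, `κ > 0`): existence of energy solutions (Galerkin), uniqueness
of weak solutions in `L^∞L²` (DiPerna–Lions / Le Bris–Lions; tree: `PassiveScalarRenormalizedSlice`,
`PassiveScalarCommutatorSobolev`, `PassiveScalarEnergy*`, `PassiveScalarExistence*`), energy equality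
and the cross-pairing identity. Releases from `s > 0` only (the value at `s = 0` is Cesàro-null).
Uses `∫h = 0` and the variance bound `R` (= the energy ceiling through S1): cf.
`Negative.twohalfdNeg_false_without_zeroMeanForce`, `_without_energyBound`. Size M–L. -/
theorem stub_ageDecoupling :
    ∀ (g : UnitAddTorus (Fin 2) → EuclideanSpace ℝ (Fin 2)) (h : UnitAddTorus (Fin 2) → ℝ),
      Torus.IsSmooth g → Torus.IsDivFree g → Torus.HasZeroMean g →
      Torus.IsSmooth h → Torus.HasZeroMean h →
      ∀ (ν : ℕ → ℝ) (v₀ : ℕ → UnitAddTorus (Fin 2) → EuclideanSpace ℝ (Fin 2))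
        (v : ℕ → ℝ → UnitAddTorus (Fin 2) → EuclideanSpace ℝ (Fin 2))
        (θ₀ : ℕ → UnitAddTorus (Fin 2) → ℝ) (θ : ℕ → ℝ → UnitAddTorus (Fin 2) → ℝ),
        (∀ j, 0 < ν j) →
        (∀ j, Torus.IsGlobalLerayHopf (ν j) (fun _ => g) (v₀ j) (v j)) →
        (∀ j, MemLp (θ₀ j) 2 volume) →
        (∀ j, Torus.IsWeakScalarTransportForced (ν j) (v j) (fun _ => h) (θ₀ j) (θ j)) →
        (∃ E : ℝ, ∀ j, longTimeAvgSup (fun t => Torus.scalarL2Sq (θ j t)) ≤ E) →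
        (∀ S : ℝ, 0 < S → ∀ ϑ : ℕ → ℝ → ℝ → UnitAddTorus (Fin 2) → ℝ,
          (∀ j (s : ℝ), 0 < s →
            Torus.IsWeakScalarTransportOn (S + 1) (ν j) (fun τ => v j (s + τ)) h (ϑ j s)) →
          Tendsto (fun j => longTimeAvgSup
            (fun s => (Torus.eScalarDissipation (ν j) (ϑ j s) 0 S).toReal)) atTop (𝓝 0)) →
        Tendsto (fun j => longTimeAvgSup
          (fun t => ν j * (Torus.eScalarGradNormSq (θ j t)).toReal)) atTop (𝓝 0) := by
  sorry

/-! ## S4 — the engine: the windowed logarithmic bound for releases (K1, load-bearing lemma) -/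

/-- **S4 `stub_releaseLogBound` — a release cannot dissipate more than the fraction
`(strain budget + 1)/log(1/κ)` of its variance inside a window (Batchelor's logarithm as a theorem, at
Sobolev level).** For every dimension, sup-norm bounds `|h| ≤ H`, `‖∇h‖ ≤ L` on the (smooth) datum and
a maximal window length `T₀` there are `κ₀ ∈ (0,1)` and `C ≥ 0` such that: for every diffusivity
`κ ≤ κ₀`, window `T ≤ T₀`, every drift `u ∈ L^∞(0,T;L²)` with time-INTEGRATED strain
`∫₀ᵀ‖∇u(t)‖_{L²}dt ≤ S` (spectral `eGradNormSq`, square root, lower Lebesgue integral) and every weak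
solution `θ` of `∂ₜθ + u·∇θ = κΔθ`, `θ(0) = h` on `[0,T)` (class `IsWeakScalarTransportOn`, which
carries `div u = 0`): `κ∫₀ᵀ‖∇θ‖² ≤ C(S + 1)/log(1/κ)`. Why true (triage r1-3 Appendix A2, the
two-point / doubled-variable Kantorovich argument; the card's per-level-set/coarea engine is the
doubted alternative, Bruè–Nguyen's stochastic-flow proof the printed `p > 2` one): for smooth `u` let
`Θ` solve the doubled equation `∂ₜΘ + u(x)·∇ₓΘ + u(y)·∇_yΘ = κ(Δₓ+Δ_y)Θ` on `T^d × T^d`; product data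
stay products (uniqueness), so `‖θ(T)‖² = ∫Θ^{h⊗h}(T,x,x)dx` and `F ↦ π_T(F) := ∫(S_TF)(x,x)dx` is a
probability measure (maximum principle) with Lebesgue marginals (mean conservation); then
`κ∫₀ᵀ‖∇θ‖² = ½(‖h‖² - ‖θ(T)‖²) = ¼∫|h(x)-h(y)|²dπ_T ≤ ¼L²ℓ² + H²·π_T{dist ≥ ℓ}`; with the smooth
cost `Φ_δ(x,y) = log(1 + δ⁻²Σᵢsin²(π(xᵢ-yᵢ)))`, `δ² = κ`, Duhamel in the starting time gives
`∫Φ_δ dπ_T = ∫₀ᵀ π_{s→T}(L_sΦ_δ)ds`, `L_sΦ_δ = (u(x)-u(y))·∇ₓΦ_δ + κ(Δₓ+Δ_y)Φ_δ ≤ c(Ψ_s(x)+Ψ_s(y)) + c_dκ/δ²`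
where `Ψ_s` is the two-point maximal function of `u(s)` (`Torus.exists_twoPoint_maximal`:
`‖u x - u y‖ ≤ dist(x,y)(Ψ x + Ψ y)`, `‖Ψ‖₂² ≤ C_d‖∇u‖₂²`), whence by the Lebesgue marginals
`∫Φ_δ dπ_T ≤ c'∫₀ᵀ‖∇u‖₂ + c_d T ≤ c'(S + T₀)` and Markov with `ℓ² = √κ`,
`log(1+ℓ²/κ) ≥ ¼log(1/κ)`: `κ∫‖∇θ‖² ≤ ¼L²√κ + 4H²c'(S+T₀)/log(1/κ) ≤ C(S+1)/log(1/κ)`. General weak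
`u ∈ L^∞L² ∩ L¹Ḣ¹`, `θ ∈ L^∞L²`: DiPerna–Lions uniqueness for `W^{1,2}` drifts with `κ > 0`
(Le Bris–Lions), mollify `u`, pass to the limit with weak l.s.c. of the dissipation — exactly Seis's
standing well-posedness class (`Seis2022_rmk1_L2_holds` is proved in tree in this class:
`SeisSliceIncrement`, `SeisTimeChain`, `KantorovichTransportInequality`, `KantorovichLogDistance`,
`SobolevCommutatorL1`, `exists_unique_isClassicalScalarTransportForcedOn_holds` for the doubled
classical problem). Calibration (card, by hand): pure strain `S·t` — dissipated fraction
`1 - exp(-(4π²κ/S)(e^{2ST}-1))`, `o(1)` iff `ST < ½log(S/4π²κ) + O(1)`: consistent; `u = 0`: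
`≤ ¼L²κT ≪ 1/log`. Constants depend on the ONE profile through `H, L` only — cf.
`Negative.twohalfdNeg_false_without_fixedForce` (`L_j → ∞` along the refuting family). Size L. -/
theorem stub_releaseLogBound :
    ∀ {d : Type} [Fintype d] [DecidableEq d] (H L T₀ : ℝ), 0 < T₀ →
      ∃ κ₀ C : ℝ, 0 < κ₀ ∧ κ₀ < 1 ∧ 0 ≤ C ∧
        ∀ (κ T S : ℝ) (u : ℝ → UnitAddTorus d → EuclideanSpace ℝ d) (h : UnitAddTorus d → ℝ)
          (θ : ℝ → UnitAddTorus d → ℝ),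
          0 < κ → κ ≤ κ₀ → 0 < T → T ≤ T₀ → 0 ≤ S →
          (∃ M : ℝ≥0, ∀ᵐ t ∂(volume.restrict (Set.Ioo 0 T)), ∫⁻ x, ‖u t x‖ₑ ^ 2 ≤ M) →
          ∫⁻ t in Set.Ioo 0 T, Torus.eGradNormSq (u t) ^ (1 / 2 : ℝ) ≤ ENNReal.ofReal S →
          Torus.IsSmooth h → (∀ x, |h x| ≤ H) → (∀ x, ‖Torus.gradient h x‖ ≤ L) →
          Torus.IsWeakScalarTransportOn T κ u h θ →
          Torus.eScalarDissipation κ θ 0 T ≤ ENNReal.ofReal (C * (S + 1) / Real.log κ⁻¹) := by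
  sorry

/-! ## S5 — combination: the engine + sub-log mean strain ⇒ finite-window quiet -/

/-- **S5 `stub_quietOfSubLog` — below `o(log(1/ν))` mean planar strain, releases are finite-window
quiet.** HYPOTHESES: the release bound of S4 (instantiated on `T²`); a smooth divergence-free
mean-zero steady `g`; `ν_j → 0`; global Leray–Hopf `v_j` (force `g`) with bounded mean energy whose
limsup-mean strain is sub-logarithmic, `⟨‖∇v_j‖_{L²}⟩/log(1/ν_j) → 0`. CONCLUSION: for every smooth
mean-zero `h`, every `S > 0` and every family of weak releases `ϑ j s` of `h` at times `s > 0` into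
`v_j` (weak on `[0,S+1)`), the long-time mean over `s` of the age-`S` dissipation tends to `0`.
Why true: for `j` large (`ν_j ≤ κ₀(H,L,S+1)`), S4 with `T = S+1`, `u = v_j(s+·)` (in `L^∞L²` by the
Leray–Hopf energy bound on `(0, s+S+1)`, strain budget `S_j(s) = ∫_s^{s+S+1}‖∇v_j‖ < ∞` by
`memL2Sobolev`) gives `D_j(s;S) ≤ D_j(s;S+1) ≤ C(S_j(s)+1)/log(1/ν_j)` (monotonicity of the lower
integral in the window); the sliding-window bound `⟨∫_s^{s+S+1}φ⟩_s ≤ (S+1)⟨φ⟩` for `φ = ‖∇v_j(·)‖ ≥ 0`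
(Fubini; Cesàro means of `φ` are bounded at fixed `j` by the energy inequality and Jensen) yields
`⟨D_j(·;S)⟩ ≤ C((S+1)⟨‖∇v_j‖⟩ + 1)/log(1/ν_j) → 0`. Junk is harmless: a non-measurable `s ↦ D_j(s)`
has Bochner time-means `0`; `log(1/ν_j) > 0` eventually. No uniqueness of releases is needed (S4 bounds
EVERY weak release). Size M (limsup/`toReal` bookkeeping). -/
theorem stub_quietOfSubLog :
    (∀ (H L T₀ : ℝ), 0 < T₀ →
      ∃ κ₀ C : ℝ, 0 < κ₀ ∧ κ₀ < 1 ∧ 0 ≤ C ∧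
        ∀ (κ T S : ℝ) (u : ℝ → UnitAddTorus (Fin 2) → EuclideanSpace ℝ (Fin 2))
          (h : UnitAddTorus (Fin 2) → ℝ) (θ : ℝ → UnitAddTorus (Fin 2) → ℝ),
          0 < κ → κ ≤ κ₀ → 0 < T → T ≤ T₀ → 0 ≤ S →
          (∃ M : ℝ≥0, ∀ᵐ t ∂(volume.restrict (Set.Ioo 0 T)), ∫⁻ x, ‖u t x‖ₑ ^ 2 ≤ M) →
          ∫⁻ t in Set.Ioo 0 T, Torus.eGradNormSq (u t) ^ (1 / 2 : ℝ) ≤ ENNReal.ofReal S →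
          Torus.IsSmooth h → (∀ x, |h x| ≤ H) → (∀ x, ‖Torus.gradient h x‖ ≤ L) →
          Torus.IsWeakScalarTransportOn T κ u h θ →
          Torus.eScalarDissipation κ θ 0 T ≤ ENNReal.ofReal (C * (S + 1) / Real.log κ⁻¹)) →
    ∀ g : UnitAddTorus (Fin 2) → EuclideanSpace ℝ (Fin 2),
      Torus.IsSmooth g → Torus.IsDivFree g → Torus.HasZeroMean g →
      ∀ (ν : ℕ → ℝ) (v₀ : ℕ → UnitAddTorus (Fin 2) → EuclideanSpace ℝ (Fin 2))
        (v : ℕ → ℝ → UnitAddTorus (Fin 2) → EuclideanSpace ℝ (Fin 2)),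
        (∀ j, 0 < ν j) → Tendsto ν atTop (𝓝 0) →
        (∀ j, Torus.IsGlobalLerayHopf (ν j) (fun _ => g) (v₀ j) (v j)) →
        (∃ E : ℝ, ∀ j, meanEnergy (v j) ≤ E) →
        Tendsto (fun j => longTimeAvgSup (fun t => Real.sqrt (Torus.eGradNormSq (v j t)).toReal) /
          Real.log (ν j)⁻¹) atTop (𝓝 0) →
        ∀ h : UnitAddTorus (Fin 2) → ℝ, Torus.IsSmooth h → Torus.HasZeroMean h →
        ∀ S : ℝ, 0 < S → ∀ ϑ : ℕ → ℝ → ℝ → UnitAddTorus (Fin 2) → ℝ,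
          (∀ j (s : ℝ), 0 < s →
            Torus.IsWeakScalarTransportOn (S + 1) (ν j) (fun τ => v j (s + τ)) h (ϑ j s)) →
          Tendsto (fun j => longTimeAvgSup
            (fun s => (Torus.eScalarDissipation (ν j) (ϑ j s) 0 S).toReal)) atTop (𝓝 0) := by
  sorry

/-! ## S6 — the TRANSFER target C⁺: sub-logarithmic mean planar strain (the open residual) -/

/-- **S6 `stub_subLogStrain` — C⁺ = `SubLogStrain` (the crux transferred to two-dimensional
Navier–Stokes alone).** For every steady smooth divergence-free mean-zero `g` on `T²`, every
`ν_j → 0` and every family of global Leray–Hopf solutions with `ν`-uniformly bounded limsup-mean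
energy: `⟨‖∇v_j‖_{L²}⟩ = o(log(1/ν_j))` (limsup long-time mean of `t ↦ ‖∇v_j(t)‖_{L²} = ‖ω_j(t)‖_{L²}`).
Status: OPEN — this is where the crux now lives. Known: `⟨‖∇v_j‖²⟩ ≤ E^{3/4}‖Δg‖^{1/2}ν_j^{-1/2}`
(Alexakis–Doering §2; all budget methods saturate there); TRUE with `⟨‖ω_j‖²⟩ = O(1)` in every settled
sub-case of the crux (first shell / Marchioro, single shell and band pincer — Tran–Shepherd
`⟨‖Δv‖²⟩ = λ⟨‖∇v‖²⟩`, tree `GravestModeLaminarAttractorShellPincer/BandPincer` —, swept first-mode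
states, the cargo slice `h = c·curl g`); predicted with margin `log^{2/3}` by Kraichnan–Batchelor
(`⟨‖ω‖₂⟩ ~ χ^{1/3}log^{1/3}(1/ν)`). WHY IT MIGHT FAIL (triage r1-1/r1-2): an 'A–D-extremal' family —
`O(1)` energy organised in `√ν` velocity-jump layers / scale-`ν^{1/4}` structures (`⟨‖ω‖²⟩ ~ ν^{-1/2}`),
e.g. a Prandtl–Batchelor-type steady or slowly drifting state under a fixed `g`, should one exist at
bounded energy — would refute S6 WITHOUT refuting the crux (such states mix only algebraically);
the reshape is then to the Lagrangian residual `PlanarQuietAll` ("every bounded-energy steadily forced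
planar LH family is finite-window quiet", the conclusion of S5 for all families), which replaces
S4+S5+S6 in `TwohalfdNeg_of` verbatim. Any proof must use that `g` is ONE fixed smooth steady field
(false for Cheskidov / Johansson–Sorella `ν`-dependent planar forcing, whose strain grows like a power
of `1/ν`): barrier `Cheskidov2023_thm13_not_forceRobustNoAnomaly` respected by construction
(vorticity-level, `‖Δg‖`-dependent budgets are outside the refuted class, scope caveat (d)).
Cheapest falsifier: DNS/lookup of `Z(ν)/log²(1/ν)` for two-shell steady `g` at zero momentum. Size XL. -/
theorem stub_subLogStrain :
    ∀ g : UnitAddTorus (Fin 2) → EuclideanSpace ℝ (Fin 2),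
      Torus.IsSmooth g → Torus.IsDivFree g → Torus.HasZeroMean g →
      ∀ (ν : ℕ → ℝ) (v₀ : ℕ → UnitAddTorus (Fin 2) → EuclideanSpace ℝ (Fin 2))
        (v : ℕ → ℝ → UnitAddTorus (Fin 2) → EuclideanSpace ℝ (Fin 2)),
        (∀ j, 0 < ν j) → Tendsto ν atTop (𝓝 0) →
        (∀ j, Torus.IsGlobalLerayHopf (ν j) (fun _ => g) (v₀ j) (v j)) →
        (∃ E : ℝ, ∀ j, meanEnergy (v j) ≤ E) →
        Tendsto (fun j => longTimeAvgSup (fun t => Real.sqrt (Torus.eGradNormSq (v j t)).toReal) /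
          Real.log (ν j)⁻¹) atTop (𝓝 0) := by
  sorry

/-! ## The composition (kernel-checked; no `sorry` of its own) -/

/-- **`TwohalfdNeg` from S1–S6.** Split the `x₃`-invariant family (S1); the planar dissipation tends
to `0` (S2); the planar family has sub-log mean strain (S6), hence its releases of `h` are
finite-window quiet (S5 fed with the engine S4), hence the sourced scalar's dissipation tends to `0`
(S3); squeeze the sub-split total dissipation between `0` (`meanDissipation_nonneg`) and the sum. -/
theorem TwohalfdNeg_of :
    Summit.AnomalousDissipation.AnomalousDissipation.Theses.TwoAndHalfD.TwohalfdNeg := by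
  intro f hfinv hfs hfd hfz ν u₀ u hν hν0 hLH huinv hE
  obtain ⟨g, h, v₀, v, θ₀, θ, hgs, hgd, hgz, hhs, hhz, -, -, hvLH, hθ₀, hθw, hEv, hEθ, hsplit⟩ :=
    stub_reduction f hfinv hfs hfd hfz ν u₀ u hν hLH huinv hE
  have hplanar : Tendsto (fun j => meanDissipation (ν j) (v j)) atTop (𝓝 0) :=
    stub_planarNoAnomaly g hgs hgd hgz ν v₀ v hν hν0 hvLH hEv
  have hsub := stub_subLogStrain g hgs hgd hgz ν v₀ v hν hν0 hvLH hEv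
  have hquiet := stub_quietOfSubLog (stub_releaseLogBound (d := Fin 2)) g hgs hgd hgz ν v₀ v hν hν0
    hvLH hEv hsub h hhs hhz
  have hscalar : Tendsto (fun j => longTimeAvgSup
      (fun t => ν j * (Torus.eScalarGradNormSq (θ j t)).toReal)) atTop (𝓝 0) :=
    stub_ageDecoupling g h hgs hgd hgz hhs hhz ν v₀ v θ₀ θ hν hvLH hθ₀ hθw hEθ hquiet
  have hsum : Tendsto (fun j => meanDissipation (ν j) (v j) +
      longTimeAvgSup (fun t => ν j * (Torus.eScalarGradNormSq (θ j t)).toReal)) atTop (𝓝 0) := by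
    simpa using hplanar.add hscalar
  exact squeeze_zero (fun j => meanDissipation_nonneg (hν j).le (u j)) hsplit hsum

end Summit.AnomalousDissipation.AnomalousDissipation.Cruxes.TwohalfdNeg.LogKantorovichEnstrophyTransfer
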